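import Mathlib

/-!
# Route BalabanIR — crux 3 `BirBdGPhaseCoercivity` (item `stmt-HubbardSuperconductivity-2081`):
# VIII. The log-det (imaginary-mass) representation of the trace norm

First lemmas of the crux idea `feshbach-shell-logdet` (Cruxes/BirBdGPhaseCoercivity/Ideas): the trace
norm of a Hermitian matrix is a superposition of massive free-fermion determinants,
`Σ_i |λ_i(A)| = π⁻¹ ∫₀^∞ log det(1 + A²/s²) ds`,
from the scalar integral `∫₀^∞ log(1 + a²/s²) ds = π|a|` (antiderivative
`s log(1 + a²/s²) + 2|a| arctan(s/|a|)`) and the spectral theorem.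

* `hasDerivAt_mul_log_one_add_sq_div_sq` — the antiderivative;
* `integral_Ioi_log_one_add_sq_div_sq` — `∫_{(0,∞)} log(1 + a²/s²) ds = π|a|`, with integrability
  `integrableOn_log_one_add_sq_div_sq`;
* `det_one_add_inv_sq_smul_sq` — `det(1 + s⁻²A²) = Π_i (1 + λ_i²/s²)` for Hermitian `A`;
* `sum_abs_eigenvalues_eq_integral_logdet` — the representation.

References: the idea card `feshbach-shell-logdet` (ideator 2, 2026-08-16); R. Bhatia, *Matrix Analysis*
(1997), §V.4 / X.1-type integral representations (`|x| = π⁻¹∫₀^∞ log(1 + x²/s²) ds`). No definition is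
introduced.
-/

noncomputable section

open scoped ComplexOrder

namespace Summit.HubbardSuperconductivity.HubbardSuperconductivity.Theorems

open Matrix MeasureTheory Filter Topology Set

/-! ### The scalar integral `∫₀^∞ log(1 + a²/s²) ds = π|a|` -/

/-- The antiderivative of `log(1 + a²/s²)` on `(0,∞)`:
`d/ds [s log(1 + a²/s²) + 2|a| arctan(s/|a|)] = log(1 + a²/s²)` (`a ≠ 0`). [folklore] -/
theorem hasDerivAt_mul_log_one_add_sq_div_sq {a : ℝ} (ha : a ≠ 0) {s : ℝ} (hs : 0 < s) :
    HasDerivAt (fun s : ℝ => s * Real.log (1 + a ^ 2 / s ^ 2) + 2 * |a| * Real.arctan (s / |a|))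
      (Real.log (1 + a ^ 2 / s ^ 2)) s := by
  have hapos : 0 < |a| := abs_pos.2 ha
  have hs0 : s ≠ 0 := hs.ne'
  have h1 : 0 < 1 + a ^ 2 / s ^ 2 := by positivity
  -- derivative of `s ↦ a²/s²`
  have hq : HasDerivAt (fun s : ℝ => a ^ 2 / s ^ 2) (-(2 * a ^ 2) / s ^ 3) s := by
    have h := (hasDerivAt_const s (a ^ 2)).div (hasDerivAt_pow 2 s) (pow_ne_zero 2 hs0)
    refine h.congr_deriv ?_
    field_simp
    ring
  have hlog : HasDerivAt (fun s : ℝ => Real.log (1 + a ^ 2 / s ^ 2))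
      ((-(2 * a ^ 2) / s ^ 3) / (1 + a ^ 2 / s ^ 2)) s := by
    have := (hq.const_add 1).log h1.ne'
    convert this using 1
  have hmul : HasDerivAt (fun s : ℝ => s * Real.log (1 + a ^ 2 / s ^ 2))
      (1 * Real.log (1 + a ^ 2 / s ^ 2) + s * ((-(2 * a ^ 2) / s ^ 3) / (1 + a ^ 2 / s ^ 2))) s :=
    (hasDerivAt_id' s).mul hlog
  have harc : HasDerivAt (fun s : ℝ => 2 * |a| * Real.arctan (s / |a|))
      (2 * |a| * ((1 / (1 + (s / |a|) ^ 2)) * (1 / |a|))) s := by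
    have h := (Real.hasDerivAt_arctan (s / |a|)).comp s ((hasDerivAt_id s).div_const |a|)
    simpa using h.const_mul (2 * |a|)
  have hsum : HasDerivAt (fun s : ℝ => s * Real.log (1 + a ^ 2 / s ^ 2) + 2 * |a| * Real.arctan (s / |a|))
      (1 * Real.log (1 + a ^ 2 / s ^ 2) + s * ((-(2 * a ^ 2) / s ^ 3) / (1 + a ^ 2 / s ^ 2)) +
        2 * |a| * ((1 / (1 + (s / |a|) ^ 2)) * (1 / |a|))) s := hmul.add harc
  refine hsum.congr_deriv ?_
  have hane : |a| ≠ 0 := hapos.ne'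
  field_simp
  simp only [sq_abs]
  ring

/-- Continuity of the antiderivative at `0⁺`: `s log(1 + a²/s²) → 0` as `s → 0⁺` (`a ≠ 0`). [folklore] -/
theorem tendsto_mul_log_one_add_sq_div_sq_zero {a : ℝ} (ha : a ≠ 0) :
    Tendsto (fun s : ℝ => s * Real.log (1 + a ^ 2 / s ^ 2)) (𝓝[>] 0) (𝓝 0) := by
  -- on `(0,∞)`: `s log(1 + a²/s²) = s log(s² + a²) - 2 (log s · s)`
  have heq : ∀ s ∈ Set.Ioi (0 : ℝ), s * Real.log (s ^ 2 + a ^ 2) - 2 * (Real.log s * s ^ (1 : ℝ)) =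
      s * Real.log (1 + a ^ 2 / s ^ 2) := by
    intro s hs
    have hs0 : (s : ℝ) ≠ 0 := (ne_of_gt hs)
    rw [Real.rpow_one]
    have : 1 + a ^ 2 / s ^ 2 = (s ^ 2 + a ^ 2) / s ^ 2 := by field_simp
    rw [this, Real.log_div (by positivity) (pow_ne_zero 2 hs0), Real.log_pow]
    push_cast
    ring
  have h1 : Tendsto (fun s : ℝ => s * Real.log (s ^ 2 + a ^ 2)) (𝓝[>] 0) (𝓝 0) := by
    have hc : ContinuousAt (fun s : ℝ => s * Real.log (s ^ 2 + a ^ 2)) 0 := by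
      have ha2 : (0 : ℝ) ^ 2 + a ^ 2 ≠ 0 := by positivity
      exact continuousAt_id.mul ((continuousAt_id.pow 2).add continuousAt_const |>.log ha2)
    have := hc.tendsto
    simp only [zero_mul] at this
    exact this.mono_left nhdsWithin_le_nhds
  have h2 : Tendsto (fun s : ℝ => 2 * (Real.log s * s ^ (1 : ℝ))) (𝓝[>] 0) (𝓝 0) := by
    have := (tendsto_log_mul_rpow_nhdsGT_zero one_pos).const_mul 2
    simpa using this
  have h := h1.sub h2
  rw [sub_zero] at h
  exact h.congr' (eventually_nhdsWithin_of_forall heq)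

/-- The antiderivative tends to `π|a|` at `+∞`. [folklore] -/
theorem tendsto_antideriv_log_one_add_sq_div_sq_atTop {a : ℝ} (ha : a ≠ 0) :
    Tendsto (fun s : ℝ => s * Real.log (1 + a ^ 2 / s ^ 2) + 2 * |a| * Real.arctan (s / |a|)) atTop
      (𝓝 (Real.pi * |a|)) := by
  have hapos : 0 < |a| := abs_pos.2 ha
  -- `0 ≤ s log(1 + a²/s²) ≤ a²/s → 0`
  have h1 : Tendsto (fun s : ℝ => s * Real.log (1 + a ^ 2 / s ^ 2)) atTop (𝓝 0) := by
    have hup : Tendsto (fun s : ℝ => a ^ 2 / s) atTop (𝓝 0) :=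
      tendsto_const_nhds.div_atTop tendsto_id
    refine tendsto_of_tendsto_of_tendsto_of_le_of_le' tendsto_const_nhds hup ?_ ?_
    · filter_upwards [eventually_gt_atTop 0] with s hs
      exact mul_nonneg hs.le (Real.log_nonneg (by have := div_nonneg (sq_nonneg a) (sq_nonneg s); linarith))
    · filter_upwards [eventually_gt_atTop 0] with s hs
      have hx : 0 ≤ a ^ 2 / s ^ 2 := div_nonneg (sq_nonneg a) (sq_nonneg s)
      have hlog : Real.log (1 + a ^ 2 / s ^ 2) ≤ a ^ 2 / s ^ 2 := by
        have := Real.log_le_sub_one_of_pos (by linarith : 0 < 1 + a ^ 2 / s ^ 2)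
        linarith
      calc s * Real.log (1 + a ^ 2 / s ^ 2) ≤ s * (a ^ 2 / s ^ 2) :=
            mul_le_mul_of_nonneg_left hlog hs.le
        _ = a ^ 2 / s := by field_simp
  have h2 : Tendsto (fun s : ℝ => 2 * |a| * Real.arctan (s / |a|)) atTop (𝓝 (2 * |a| * (Real.pi / 2))) := by
    have ht : Tendsto (fun s : ℝ => s / |a|) atTop atTop := tendsto_id.atTop_div_const hapos
    have harc : Tendsto (fun s : ℝ => Real.arctan (s / |a|)) atTop (𝓝 (Real.pi / 2)) :=
      (Real.tendsto_arctan_atTop.mono_right nhdsWithin_le_nhds).comp ht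
    exact harc.const_mul (2 * |a|)
  have h := h1.add h2
  convert h using 2
  ring

/-- Continuity of the antiderivative at `0` from the right (within `[0,∞)`). [folklore] -/
theorem continuousWithinAt_antideriv_log_one_add_sq_div_sq {a : ℝ} (ha : a ≠ 0) :
    ContinuousWithinAt
      (fun s : ℝ => s * Real.log (1 + a ^ 2 / s ^ 2) + 2 * |a| * Real.arctan (s / |a|)) (Set.Ici 0) 0 := by
  rw [← continuousWithinAt_Ioi_iff_Ici, ContinuousWithinAt]
  have h1 := tendsto_mul_log_one_add_sq_div_sq_zero ha
  have h2 : Tendsto (fun s : ℝ => 2 * |a| * Real.arctan (s / |a|)) (𝓝[>] 0) (𝓝 0) := by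
    have hc : ContinuousAt (fun s : ℝ => 2 * |a| * Real.arctan (s / |a|)) 0 :=
      continuousAt_const.mul
        (Real.continuous_arctan.continuousAt.comp (continuous_id.div_const |a|).continuousAt)
    have := hc.tendsto
    simp only [zero_div, Real.arctan_zero, mul_zero] at this
    exact this.mono_left nhdsWithin_le_nhds
  have h := h1.add h2
  rw [add_zero] at h
  convert h using 2; simp

/-- Nonnegativity of the integrand. [folklore] -/
theorem log_one_add_sq_div_sq_nonneg (a s : ℝ) : 0 ≤ Real.log (1 + a ^ 2 / s ^ 2) :=
  Real.log_nonneg (by have := div_nonneg (sq_nonneg a) (sq_nonneg s); linarith)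

/-- **`∫₀^∞ log(1 + a²/s²) ds = π|a|`.** [folklore] -/
theorem integral_Ioi_log_one_add_sq_div_sq (a : ℝ) :
    ∫ s in Set.Ioi (0 : ℝ), Real.log (1 + a ^ 2 / s ^ 2) = Real.pi * |a| := by
  rcases eq_or_ne a 0 with rfl | ha
  · simp
  have hcont := continuousWithinAt_antideriv_log_one_add_sq_div_sq ha
  rw [integral_Ioi_of_hasDerivAt_of_nonneg hcont
    (fun s hs => hasDerivAt_mul_log_one_add_sq_div_sq ha hs)
    (fun s _ => log_one_add_sq_div_sq_nonneg a s) (tendsto_antideriv_log_one_add_sq_div_sq_atTop ha)]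
  simp

/-- Integrability of `log(1 + a²/s²)` on `(0,∞)`. [folklore] -/
theorem integrableOn_log_one_add_sq_div_sq (a : ℝ) :
    IntegrableOn (fun s : ℝ => Real.log (1 + a ^ 2 / s ^ 2)) (Set.Ioi 0) := by
  rcases eq_or_ne a 0 with rfl | ha
  · simp
  have hcont := continuousWithinAt_antideriv_log_one_add_sq_div_sq ha
  exact integrableOn_Ioi_deriv_of_nonneg hcont
    (fun s hs => hasDerivAt_mul_log_one_add_sq_div_sq ha hs)
    (fun s _ => log_one_add_sq_div_sq_nonneg a s) (tendsto_antideriv_log_one_add_sq_div_sq_atTop ha)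

/-! ### The determinant `det(1 + A²/s²)` and the log-det representation -/

section MatrixPart

variable {n : Type*} [Fintype n] [DecidableEq n]

/-- `det(1 + s⁻² A²) = Π_i (1 + λ_i(A)²/s²)` for a Hermitian matrix `A` (spectral theorem; for `s = 0`
both sides are `1` with Lean's `0⁻¹ = 0`). [folklore] -/
theorem det_one_add_inv_sq_smul_sq (A : Matrix n n ℂ) (hA : A.IsHermitian) (s : ℝ) :
    (1 + ((s : ℂ)⁻¹ ^ 2) • (A * A)).det = ((∏ i, (1 + hA.eigenvalues i ^ 2 / s ^ 2) : ℝ) : ℂ) := by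
  set U : Matrix n n ℂ := (hA.eigenvectorUnitary : Matrix n n ℂ) with hUdef
  have hU : U ∈ Matrix.unitaryGroup n ℂ := hA.eigenvectorUnitary.2
  have hUU : star U * U = 1 := Unitary.star_mul_self_of_mem hU
  have hUU' : U * star U = 1 := Unitary.mul_star_self_of_mem hU
  set D : Matrix n n ℂ := diagonal (RCLike.ofReal ∘ hA.eigenvalues) with hDdef
  have hspec : A = U * D * star U := by
    have := hA.spectral_theorem
    rw [Unitary.conjStarAlgAut_apply] at this
    exact this
  have hAA : A * A = U * (D * D) * star U := by
    conv_lhs => rw [hspec]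
    calc U * D * star U * (U * D * star U) = U * D * (star U * U) * D * star U := by
          simp only [Matrix.mul_assoc]
      _ = U * (D * D) * star U := by rw [hUU, Matrix.mul_one, Matrix.mul_assoc U D D]
  have hconj : 1 + ((s : ℂ)⁻¹ ^ 2) • (A * A) = U * (1 + ((s : ℂ)⁻¹ ^ 2) • (D * D)) * star U := by
    rw [hAA, Matrix.mul_add, Matrix.add_mul, Matrix.mul_one, hUU', Matrix.mul_smul, Matrix.smul_mul]
  have hdetU : U.det * (star U).det = 1 := by
    rw [← Matrix.det_mul, hUU', Matrix.det_one]
  rw [hconj, Matrix.det_mul, Matrix.det_mul,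
    show U.det * (1 + ((s : ℂ)⁻¹ ^ 2) • (D * D)).det * (star U).det =
      (U.det * (star U).det) * (1 + ((s : ℂ)⁻¹ ^ 2) • (D * D)).det by ring, hdetU, one_mul]
  -- the diagonal determinant
  rw [hDdef, Matrix.diagonal_mul_diagonal, ← Matrix.diagonal_smul, ← Matrix.diagonal_one,
    Matrix.diagonal_add, Matrix.det_diagonal]
  push_cast
  refine Finset.prod_congr rfl fun i _ => ?_
  simp only [Function.comp_apply, Pi.smul_apply, smul_eq_mul]
  have hcast : (RCLike.ofReal (hA.eigenvalues i) : ℂ) = ((hA.eigenvalues i : ℝ) : ℂ) := rfl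
  rw [hcast, div_eq_mul_inv, ← inv_pow]
  ring

/-- The integrand of the log-det representation, eigenvalue by eigenvalue:
`log det(1 + s⁻²A²) = Σ_i log(1 + λ_i²/s²)`. [folklore] -/
theorem log_re_det_one_add_inv_sq_smul_sq (A : Matrix n n ℂ) (hA : A.IsHermitian) (s : ℝ) :
    Real.log ((1 + ((s : ℂ)⁻¹ ^ 2) • (A * A)).det.re) =
      ∑ i, Real.log (1 + hA.eigenvalues i ^ 2 / s ^ 2) := by
  rw [det_one_add_inv_sq_smul_sq A hA s, Complex.ofReal_re, Real.log_prod]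
  intro i _
  have : 0 < 1 + hA.eigenvalues i ^ 2 / s ^ 2 := by
    have := div_nonneg (sq_nonneg (hA.eigenvalues i)) (sq_nonneg s)
    linarith
  exact this.ne'

/-- **Log-det (imaginary-mass) representation of the trace norm.** For a Hermitian matrix `A`,
`Σ_i |λ_i(A)| = π⁻¹ ∫₀^∞ log det(1 + A²/s²) ds` (first lemma
`sum_abs_eigenvalues_eq_integral_logdet` of the crux idea `feshbach-shell-logdet`). [folklore] -/
theorem sum_abs_eigenvalues_eq_integral_logdet (A : Matrix n n ℂ) (hA : A.IsHermitian) :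
    ∑ i, |hA.eigenvalues i| =
      Real.pi⁻¹ * ∫ s in Set.Ioi (0 : ℝ), Real.log ((1 + ((s : ℂ)⁻¹ ^ 2) • (A * A)).det.re) := by
  simp_rw [log_re_det_one_add_inv_sq_smul_sq A hA]
  rw [integral_finsetSum _ (fun i _ => integrableOn_log_one_add_sq_div_sq (hA.eigenvalues i))]
  simp_rw [integral_Ioi_log_one_add_sq_div_sq]
  rw [← Finset.mul_sum, ← mul_assoc, inv_mul_cancel₀ Real.pi_pos.ne', one_mul]

end MatrixPart

end Summit.HubbardSuperconductivity.HubbardSuperconductivity.Theorems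

end
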